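import Summits.QuantumFields.YangMills.Theorems.BalabanUVNodesN07FramedLettersOfThm312313
import HarnessLib

/-!
# WHAT THE DISPLAYED ANTECEDENT `B9.Thm313Printed … (frakGprFamilyRecN00 …) …` OF (R1)ᵖʳ ACTUALLY ASKS: the k-uniform (117) letter `‖𝔊^{pr}(U₀)J‖₍₁₁₅₎ ≤ B₀|J|₍₋₃₎` — nothing else

Cell `pub-ymgap` (HUMAN RULING D-0062, Track A), node N07 [B11] ∕ the K0ᴬ port wall; seat `pub-ymgap-dag-n06-l` (g43; N06 bundle F7 = [B9] Thms 3.12∕3.13 — row 21 `t313` is this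
bundle's).  Twin of ✓`…N07Thm312PrintedRecPrOfEntryRows` (p830565) for the SECOND displayed row of the K0ᴬ G-doors.  LOCATED sizing; `--kind proof --supports stmt-QuantumFields-27238 --as
helper`; count-neutral.  [B9] = [Balaban1985BackgroundPropagators]; [B11] = [Balaban1985Variational].

THE POINT.  dag-n07-e's ✓`frakGprLetterAtRecord_of_thm313Printed` reads the DISPLAYED antecedent
`B9.Thm313Printed c35 (geoRecGN00 F N) (bgRecN00 F N R35 R36) (frakGprFamilyRecN00 F N a R35 R36 𝔥 Gp Δ2) HasRWExp PosDefK` (slots `HasRWExp PosDefK` FREE).  The family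
✓`frakGprFamilyRecN00` has `e = h1 = e4 = h2 = l2 := 0` and ONLY the (3.47) global entries `glob n U J γ := globValOf (𝔊^{pr}(U)) n J` live (on `admSetPr128`, `0` elsewhere); at
✓`geoRecGN00` (`supNorm J = wNorm γ J := ‖J‖`, `l2Norm = holder = cutH = cutSup := 0`, `len ≡ 1`) every other clause of Theorem 3.13 ((3.42)∕(3.46) rows, (3.43)–(3.45)) is `0 ≤ (≥ 0)`
for this family (with `Bβ = Bε = Bεβ := 0`), and `globValOf G 2 J = 0`.  HENCE the displayed antecedent is IMPLIED BY the bare letter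
  `∃ M₄ a₀ B₀ > 0, ∀ i, M₄ ≤ Mc_i → ∀ α₀ > 0, Mc_i·α₀ ≤ a₀ → ∀ [Facts], ∀ U₀ ∈ R35 ∩ R36 (i c35 α₀), ∀ hposπ hQ, Prop4LetterH (frakGprOfRecordAtBg128 … (𝔥 i U₀) (Gp i U₀) (Δ2 i U₀) a hposπ hQ) B₀`
— which is EXACTLY what ✓`frakGprLetterAtRecord_of_thm313Printed` extracts from it: the display «Theorem 3.13 at the framed record» IS the k-uniform (R1) = [B11] (117) letter for print's
framed `𝔊 = 𝔓G₁` (its honest content: [B9] Theorem 3.3's (3.47) global bound for `𝔊` at the framed record pair, constants bound BEFORE the member — XL analysis, NOBODY's today);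
`HasRWExp`, `PosDefK`, Thm 3.10∕3.11 are NOT read by any consumer of this display.
* ★ `thm313Printed_recPr_of_prop4LetterH` — the bare k-uniform (117) letter ⟹ the displayed antecedent (trivial completion; kernel-checked).
HONEST FRAMING.  Bookkeeping ONLY (a sizing lemma): NOTHING of [B9]∕[B11] is proved; the letter itself (= (R1), XL) is NOT inhabited here or anywhere in the tree; `R35 ∕ R36`, `𝔥`, `Gp`,
`Δ2`, `hposπ ∕ hQ` displayed; K0ᴬ ⟨stmt-QuantumFields-27238⟩ NOT closed; K0ᴬ∕K1ᴬ∕K3ᴬ 0∕3; NODE O 0∕1; COUNT 8∕28 · K 1∕4 UNMOVED; finite `𝕋⁴_{L^K}` at fixed ε — NOT continuum ∕ ℝ⁴ ∕ OS;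
**the Yang–Mills mass gap (Clay) is NOT proved by any of this.**  No `sorry`, `instance`, `notation`, `set_option`; standard axioms.
-/

noncomputable section

open scoped Matrix Matrix.Norms.L2Operator InnerProductSpace ComplexConjugate BigOperators

namespace Summit.QuantumFields.YangMills.BalabanUVNodes.N07Thm313PrintedRecPrOfLetterH

open Literature.MathematicalPhysics.QuantumFieldTheory.Balaban1983to89
open Literature.MathematicalPhysics.QuantumFieldTheory.Balaban1983to89.Node00
open T4Continuum (T4Family)
open B11Eq115Space (JetSup)
open Summit.QuantumFields.YangMills.BalabanUVNodes.N07Prop4LetterHOfThm312 (MemberN00 bgRecN00)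
open Summit.QuantumFields.YangMills.BalabanUVNodes.N07FrakGLetterOfThm313 (geoRecGN00 geoRecGN00_len)
open Summit.QuantumFields.YangMills.BalabanUVNodes.N07FramedLettersOfThm312313 (globValOf norm_apply_eq_max_globValOf admSetPr128 frakGprGlobVal frakGprFamilyRecN00
  frakGprFamilyRecN00_glob_eq)

variable (F : T4Family) (N : ℕ) [NeZero N] (a : ℝ)

/-- ★ **THE DISPLAYED `B9.Thm313Printed` ANTECEDENT FROM THE BARE k-UNIFORM (117) LETTER** (node-00 `𝔊`-geometry of record): if `∃ M₄ a₀ B₀ > 0` such that at every member `i`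
(`M₄ ≤ Mc_i`), every `0 < α₀` (`Mc_i·α₀ ≤ a₀`), the member's positivity `Fact`s as binders, every `U₀ ∈ R35 ∩ R36 (i c35 α₀)` and every pair of displayed proofs `hposπ hQ` of the framed
slot-(c) pair, `Prop4LetterH (frakGprOfRecordAtBg128 … (𝔥 i U₀) (Gp i U₀) (Δ2 i U₀) a hposπ hQ) B₀` (`‖𝔊^{pr}(U₀)J‖₍₁₁₅₎ ≤ B₀‖J‖₍₋₃₎`), THEN
`B9.Thm313Printed c35 (geoRecGN00 F N) (bgRecN00 F N R35 R36) (frakGprFamilyRecN00 F N a R35 R36 𝔥 Gp Δ2) ⊤ ⊤` holds (`δ₀ := 1`, `Bβ = Bε = Bεβ := 0`, predicate slots `True`): the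
(3.47) global rows `n = 0, 1` are the two jet halves `≤ ‖𝔊J‖ ≤ B₀‖J‖`, `n = 2` is `0`, every other entry of the family is `0` and every other right-hand side `≥ 0` at ✓`geoRecGN00`.
I.e. the display the K0ᴬ consumers read through ✓`frakGprLetterAtRecord_of_thm313Printed` is EXACTLY this letter ((R1) k-uniform).
[cite: Balaban1985BackgroundPropagators, Thm 3.13 p.426, Thm 3.3 (3.42)–(3.47) pp.397–398, (3.128) p.421; Balaban1985Variational, (116)–(117) p.295, (111) p.294] -/
theorem thm313Printed_recPr_of_prop4LetterH [Fact (0 < (F.L : ℝ))] {c35 : ℝ}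
    {R35 R36 : ∀ i : MemberN00 F, ℝ → ℝ → GaugeField (F.P i.K) 0 (SU N) → Prop}
    {𝔥 : ∀ i : MemberN00 F, (U₀ : GaugeField (F.P i.K) 0 (SU N)) → FrameDatum (F.P i.K) N i.k U₀}
    {Gp : ∀ i : MemberN00 F, GaugeField (F.P i.K) 0 (SU N) →
      (B11Eq103H1Complex.SiteL2K ℂ (F.P i.K).d (fun _ => (F.P i.K).sitesPerDir 0) (c0Rec F i.K i.k) (WRec N) →ₗ[ℂ]
        B11Eq103H1Complex.SiteL2K ℂ (F.P i.K).d (fun _ => (F.P i.K).sitesPerDir 0) (c0Rec F i.K i.k) (WRec N))}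
    {Δ2 : ∀ i : MemberN00 F, GaugeField (F.P i.K) 0 (SU N) →
      (B11Eq103H1Complex.BondL2K ℂ (F.P i.K).d (fun _ => (F.P i.K).sitesPerDir 0) (c0Rec F i.K i.k) (WRec N) →ₗ[ℂ]
        B11Eq103H1Complex.BondL2K ℂ (F.P i.K).d (fun _ => (F.P i.K).sitesPerDir 0) (c0Rec F i.K i.k) (WRec N))}
    (h : ∃ M₄ a₀ B₀ : ℝ, 0 < M₄ ∧ 0 < a₀ ∧ 0 < B₀ ∧
      ∀ i : MemberN00 F, M₄ ≤ (i.Mc : ℝ) → ∀ α₀ : ℝ, 0 < α₀ → (i.Mc : ℝ) * α₀ ≤ a₀ →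
        ∀ [Fact (0 < (F.P i.K).eta i.k)] [Fact (0 < c0Rec F i.K i.k)] [Fact (∀ c, 0 < wBRec F i.K i.k c)],
        ∀ U₀ : GaugeField (F.P i.K) 0 (SU N), R35 i c35 α₀ U₀ → R36 i c35 α₀ U₀ →
          ∀ (hposπ : ∀ x, x ≠ 0 → 0 < RCLike.re ⟪x, laplaceAOfRecordAt F N i.k U₀ (hessOpOfRecord128 F N i.k U₀ (Gp i U₀) (QprimeOfRecord F N i.k U₀) (Δ2 i U₀))
              (QprOfRecord F N i.k U₀ (𝔥 i U₀)) (QprimeOfRecord F N i.k U₀) a x⟫_ℂ)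
            (hQ : Function.Surjective (QprOfRecord F N i.k U₀ (𝔥 i U₀))),
            Prop4LetterH (frakGprOfRecordAtBg128 F N i.K i.k i.Ω U₀ (𝔥 i U₀) (Gp i U₀) (Δ2 i U₀) a hposπ hQ) B₀) :
    B9.Thm313Printed c35 (geoRecGN00 F N) (bgRecN00 F N R35 R36) (frakGprFamilyRecN00 F N a R35 R36 𝔥 Gp Δ2)
      (fun _ _ _ _ => True) (fun _ _ _ => True) := by
  obtain ⟨M₄, a₀, B₀, hM₄, ha₀, hB₀, h⟩ := h
  refine ⟨M₄, 1, a₀, B₀, fun _ => 0, fun _ => 0, fun _ _ => 0, hM₄, one_pos, ha₀, hB₀, fun i hM α₀ hα₀ hMa U₀ h35 h36 => ?_⟩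
  haveI := factEta F i.K i.k
  haveI := factC0 F i.K i.k
  haveI := wBRec_fact F i.K i.k
  -- the (3.47) global rows: the only live entries of the family
  have hglob : ∀ (n : Fin 4) (J : NegSizeLit F N i.K i.k i.Ω 3) (γ : ℝ), n ≠ 3 →
      (frakGprFamilyRecN00 F N a R35 R36 𝔥 Gp Δ2 i).glob n U₀ J γ ≤ B₀ * ‖J‖ := by
    intro n J γ hn
    have hJ : 0 ≤ B₀ * ‖J‖ := mul_nonneg hB₀.le (norm_nonneg J)
    by_cases hadm : U₀ ∈ admSetPr128 a i 𝔥 Gp Δ2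
    · rw [frakGprFamilyRecN00_glob_eq F N a R35 R36 𝔥 Gp Δ2 i U₀ hadm]
      have hH := h i hM α₀ hα₀ hMa U₀ h35 h36 hadm.1 hadm.2 J
      have hmax := (norm_apply_eq_max_globValOf (frakGprOfRecordAtBg128 F N i.K i.k i.Ω U₀ (𝔥 i U₀) (Gp i U₀) (Δ2 i U₀) a hadm.1 hadm.2) J).symm.le.trans hH
      change globValOf _ n J ≤ B₀ * ‖J‖
      fin_cases n
      · exact (le_max_left _ _).trans hmax
      · exact (le_max_right _ _).trans hmax
      · simp only [globValOf]
        exact hJ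
      · exact absurd rfl hn
    · unfold frakGprFamilyRecN00
      dsimp only
      rw [dif_neg hadm]
      exact hJ
  refine ⟨⟨fun n J y y' _ _ => ?_, fun n J c y y' _ _ => ?_, fun n J γ hn _ _ => ?_⟩, ⟨fun β J ζ y y' _ _ _ _ => ?_, fun ε J y y' _ _ _ => ?_, fun ε β J ζ y y' _ _ _ _ _ _ => ?_⟩,
    trivial, trivial⟩
  · -- (3.42)/(3.46) sup rows: entries `0`, right-hand side `≥ 0`
    change (0 : ℝ) ≤ _
    have hlen : (0 : ℝ) ≤ (geoRecGN00 F N i).len y := by rw [geoRecGN00_len]; exact zero_le_one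
    have hp : 0 ≤ B9.pref4 ((geoRecGN00 F N i).len y) n := by
      fin_cases n <;> simp [B9.pref4, hlen]
    exact mul_nonneg (mul_nonneg (mul_nonneg hB₀.le hp) (Real.exp_nonneg _)) (norm_nonneg _)
  · change (0 : ℝ) ≤ _
    simp [geoRecGN00]
  · exact (hglob n J γ hn).trans (le_of_eq rfl)
  · change (0 : ℝ) ≤ _
    simp [geoRecGN00]
  · change (0 : ℝ) ≤ _
    simp
  · change (0 : ℝ) ≤ _
    simp [geoRecGN00]

end Summit.QuantumFields.YangMills.BalabanUVNodes.N07Thm313PrintedRecPrOfLetterH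

end
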